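import Mathlib
import Literature.AlgebraicGeometry.Resolution.TeissierPresentation
import HarnessLib

/-!
# `TeissierResolve`, line Sketch — stub `stub_transportToQuotient` (transport of structure along
# a Teissier presentation `ψ : B ≃ k⟦x⟧[u] ⧸ (E)`)

Crux `stmt-ResolutionOfSingularities-17086`
(`Summit.ResolutionOfSingularities.ResolutionOfSingularities.Theses.TeissierJung.TeissierResolve`),
line "toric normalisation + destackification". This file proves the plumbing stub
`stub_transportToQuotient` of the lead skeleton (`Cruxes/TeissierResolve/Lines/Sketch.lean`, v8),
which lets the research core of the line be stated for the concrete quotient ring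
`Q := k⟦x₁, …, x_d⟧[u₀, …, u_{g-1}] ⧸ (E₀, …, E_{g-1})` of a Teissier datum
(`Literature.AlgebraicGeometry.Resolution.Teissier.ideal`) instead of an abstract ring `B`.

## Informal statement

Let `k` be a field, `B` a domain that is a module-finite algebra over the power series ring
`k⟦x⟧ = k⟦x₁, …, x_d⟧`, and `ψ : B ≃+* Q` a ring isomorphism onto the quotient ring `Q` of a
Teissier datum which is compatible with the structure maps (`ψ (a · 1_B) = [C a]` for `a ∈ k⟦x⟧`).
Then `Q` is a domain, `Q` is module-finite over `k⟦x⟧` (for its quotient algebra structure), and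
the normalisations are ring-isomorphic:
`integralClosure B (Frac B) ≃+* integralClosure Q (Frac Q)`.

## Proof

(1) A ring isomorphic to a domain is a domain (`MulEquiv.isDomain` applied to `ψ`).
(2) The compatibility `hψ` says precisely that `ψ` commutes with the two algebra maps
`k⟦x⟧ → B` and `k⟦x⟧ → k⟦x⟧[u] → Q` (the latter is `a ↦ [C a]` by definition of the quotient
algebra structure), so `ψ` upgrades to a `k⟦x⟧`-algebra isomorphism (`AlgEquiv.ofRingEquiv`) and
module-finiteness transfers along its underlying linear equivalence (`Module.Finite.equiv`).
(3) The ring isomorphism `ψ` extends to the fraction fields,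
`Ψ : Frac B ≃+* Frac Q` with `Ψ (b / s) = ψ b / ψ s` (`IsFractionRing.ringEquivOfRingEquiv`).
Regard `Frac Q` as a `B`-algebra through `ψ`; then `Ψ` is a `B`-algebra isomorphism, so it maps
the integral closure of `B` in `Frac B` isomorphically onto the integral closure of `B` in `Frac Q`
(`AlgEquiv.mapIntegralClosure`), and an element of `Frac Q` is integral over `B` (acting through
`ψ`) iff it is integral over `Q` (`RingEquiv.isIntegral_iff`: push the monic equation through
`ψ`), so the latter subring IS the integral closure of `Q` in `Frac Q`.

Sources: N. Bourbaki, *Commutative Algebra*, Ch. V §1 no. 1–2 (integral closure; transport along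
isomorphisms is immediate from the definitions); H. Matsumura, *Commutative Ring Theory* (1986),
§9 p. 64 (integral closure, normalisation). No new definitions, no named facts. [folklore]
-/

noncomputable section

set_option linter.dupNamespace false -- mandated namespace of this single-conjunct summit

open Literature.AlgebraicGeometry.Resolution

namespace Summit.ResolutionOfSingularities.ResolutionOfSingularities.Theorems.TeissierResolve.TransportToQuotient

/-- **Normalisation is invariant under ring isomorphisms.** A ring isomorphism `e : R ≃+* R'`
induces a ring isomorphism `integralClosure R (Frac R) ≃+* integralClosure R' (Frac R')` of the
integral closures in the respective fraction rings: extend `e` to the fraction rings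
(`IsFractionRing.ringEquivOfRingEquiv`), restrict to integral closures over `R` (with `Frac R'`
an `R`-algebra through `e`; `AlgEquiv.mapIntegralClosure`), and note that integrality over `R`
through `e` is integrality over `R'` (`RingEquiv.isIntegral_iff`). [folklore] -/
theorem nonempty_integralClosure_ringEquiv {R R' : Type*} [CommRing R] [CommRing R']
    (e : R ≃+* R') :
    Nonempty (integralClosure R (FractionRing R) ≃+*
      integralClosure R' (FractionRing R')) := by
  -- `Frac R'` as an `R`-algebra through `e`
  letI algRL : Algebra R (FractionRing R') :=
    ((algebraMap R' (FractionRing R')).comp e.toRingHom).toAlgebra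
  -- the extension of `e` to fraction rings is an `R`-algebra isomorphism
  let Ψ : FractionRing R ≃ₐ[R] FractionRing R' :=
    AlgEquiv.ofRingEquiv (f := IsFractionRing.ringEquivOfRingEquiv e) fun a => by
      rw [IsFractionRing.ringEquivOfRingEquiv_algebraMap]; rfl
  -- integral over `R` (through `e`) iff integral over `R'`
  have hint : ∀ y : FractionRing R', IsIntegral R y ↔ IsIntegral R' y :=
    fun y => RingEquiv.isIntegral_iff (S := FractionRing R') e rfl y
  let f : integralClosure R (FractionRing R') ≃+* integralClosure R' (FractionRing R') :=
    { toFun := fun y => ⟨y, (hint (y : FractionRing R')).mp y.2⟩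
      invFun := fun y => ⟨y, (hint (y : FractionRing R')).mpr y.2⟩
      map_add' := fun _ _ => rfl
      map_mul' := fun _ _ => rfl
      left_inv := fun _ => rfl
      right_inv := fun _ => rfl }
  exact ⟨Ψ.mapIntegralClosure.toRingEquiv.trans f⟩

/-- **Transport along the presentation** (stub `stub_transportToQuotient` of line Sketch of
`TeissierResolve`). If `B` is a domain, module-finite over `k⟦x₁..x_d⟧`, and
`ψ : B ≃+* Q := k⟦x⟧[u₀..u_{g-1}] ⧸ (E₀..E_{g-1})` is a ring isomorphism over `k⟦x⟧` (`hψ`), then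
`Q` is a domain (`MulEquiv.isDomain`), `Q` is module-finite over `k⟦x⟧` for its quotient algebra
structure (`hψ` upgrades `ψ` to an algebra isomorphism, `AlgEquiv.ofRingEquiv`, and
`Module.Finite.equiv`), and the normalisations of `B` and `Q` are ring-isomorphic
(`nonempty_integralClosure_ringEquiv`: a ring isomorphism extends to fraction fields and preserves
integral closures). [folklore] -/
theorem stub_transportToQuotient (k : Type) [Field k] (d : ℕ) (B : Type) [CommRing B] [IsDomain B]
    [Algebra (MvPowerSeries (Fin d) k) B] [Module.Finite (MvPowerSeries (Fin d) k) B]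
    (g : ℕ) (n : Fin g → ℕ) (c : Fin g → k) (A : Fin g → (Fin d →₀ ℕ)) (mu : Fin g → (Fin g →₀ ℕ))
    (h : Fin g → MvPolynomial (Fin g) (MvPowerSeries (Fin d) k))
    (ψ : B ≃+* (MvPolynomial (Fin g) (MvPowerSeries (Fin d) k) ⧸ Teissier.ideal n c A mu h))
    (hψ : ∀ a, ψ (algebraMap (MvPowerSeries (Fin d) k) B a) =
      Ideal.Quotient.mk _ (MvPolynomial.C a)) :
    IsDomain (MvPolynomial (Fin g) (MvPowerSeries (Fin d) k) ⧸ Teissier.ideal n c A mu h) ∧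
    Module.Finite (MvPowerSeries (Fin d) k)
      (MvPolynomial (Fin g) (MvPowerSeries (Fin d) k) ⧸ Teissier.ideal n c A mu h) ∧
    Nonempty (integralClosure B (FractionRing B) ≃+*
      integralClosure (MvPolynomial (Fin g) (MvPowerSeries (Fin d) k) ⧸ Teissier.ideal n c A mu h)
        (FractionRing (MvPolynomial (Fin g) (MvPowerSeries (Fin d) k) ⧸ Teissier.ideal n c A mu h))) := by
  -- `ψ` is a `k⟦x⟧`-algebra isomorphism: `hψ` is exactly the compatibility with the algebra maps,
  -- since `algebraMap k⟦x⟧ Q a = [C a]` by definition of the quotient algebra structure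
  let ψ' : B ≃ₐ[MvPowerSeries (Fin d) k]
      (MvPolynomial (Fin g) (MvPowerSeries (Fin d) k) ⧸ Teissier.ideal n c A mu h) :=
    AlgEquiv.ofRingEquiv (f := ψ) fun a => (hψ a).trans rfl
  exact ⟨MulEquiv.isDomain B ψ.symm.toMulEquiv, Module.Finite.equiv ψ'.toLinearEquiv,
    nonempty_integralClosure_ringEquiv ψ⟩

end Summit.ResolutionOfSingularities.ResolutionOfSingularities.Theorems.TeissierResolve.TransportToQuotient

end
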